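import Summits.Parity.GeneralizedHardyLittlewood.Theses.LiouvilleShiftedTables
import Literature.NumberTheory.Sieve.LevelOfDistributionProofs
import Literature.NumberTheory.Sieve.ParityBarrierLevelProofs

/-!
# Crux `EH` (stmt-Parity-11314): the set of levels is closed — where a counterexample must live

Structure lemmas for the crux `Summit.Parity.GeneralizedHardyLittlewood.Theses.LiouvilleShiftedTables.EH`
(the Elliott–Halberstam conjecture verbatim; `Iff.rfl` with
`Literature.NumberTheory.Sieve.LevelOfDistribution.ElliottHalberstam`), sharpening the standing
disprover's localisation `¬ EH ↔ ∃ θ ∈ [1/2, 1), ¬ PrimesHaveLevel θ` (`Cruxes/EH/Disproof.lean` §6) at the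
endpoint `θ = 1/2`:

* `primesHaveLevel_of_forall_lt`, `primesHaveLevel_iff_forall_lt` — the `ε`-slack inside
  `PrimesHaveLevel` makes the set of admissible exponents `{θ | PrimesHaveLevel θ}` closed under suprema
  (a closed down-set);
* `primesHaveLevel_half` — hence the Bombieri–Vinogradov theorem (`BombieriVinogradovStatement_holds`,
  `∀ θ < 1/2`) already gives the endpoint `PrimesHaveLevel (1/2)` unconditionally;
* `exists_levelOfDistribution` — there is a number `ϑ ∈ [1/2, 1]` (the level of distribution of the
  primes) with `PrimesHaveLevel θ ↔ θ ≤ ϑ` for every real `θ`; `eh_iff_levelOfDistribution_eq_one` — the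
  crux says exactly `ϑ = 1`;
* `eh_iff_Ioo_half`, `not_eh_iff_Ioo_half` — only the OPEN interval `θ ∈ (1/2, 1)` has content: a
  counterexample to the crux, if any, lives at an exponent strictly above `1/2`, and then at every larger
  one (the failure set `(ϑ, ∞)` is open: there is no least failing exponent).
None of these asserts the crux. [folklore]
-/

namespace Summit.Parity.GeneralizedHardyLittlewood.Theorems.EH.LevelClosure

open Literature.NumberTheory.Sieve
open Summit.Parity.GeneralizedHardyLittlewood.Theses.LiouvilleShiftedTables (EH)

/-- **The set of levels is closed under suprema.** If the primes have level `x^{θ'}` for every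
`θ' < θ`, they have level `x^θ`: the `ε`-slack in `PrimesHaveLevel` absorbs the gap (take
`θ' = θ − ε/2` with slack `ε/2`). [folklore] -/
theorem primesHaveLevel_of_forall_lt {θ : ℝ} (h : ∀ θ' : ℝ, θ' < θ → PrimesHaveLevel θ') :
    PrimesHaveLevel θ := by
  intro A hA ε hε
  have h' := h (θ - ε / 2) (by linarith) A hA (ε / 2) (by linarith)
  have e : θ - ε / 2 - ε / 2 = θ - ε := by ring
  rw [e] at h'
  exact h'

/-- `PrimesHaveLevel θ ↔ ∀ θ' < θ, PrimesHaveLevel θ'` (closure under suprema plus monotonicity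
`PrimesHaveLevel.mono`). [folklore] -/
theorem primesHaveLevel_iff_forall_lt (θ : ℝ) :
    PrimesHaveLevel θ ↔ ∀ θ' : ℝ, θ' < θ → PrimesHaveLevel θ' :=
  ⟨fun h _ hθ' => h.mono hθ'.le, primesHaveLevel_of_forall_lt⟩

/-- **The endpoint of Bombieri–Vinogradov**: the primes have level `x^{1/2}` in the `ε`-form
`PrimesHaveLevel (1/2)` (`∀ A, ε > 0: ∑_{q ≤ x^{1/2−ε}} E*(x; q) ≪ x/(log x)^A`), unconditionally, from the
tree's `BombieriVinogradovStatement_holds : ∀ θ < 1/2, PrimesHaveLevel θ` (Bombieri 1965 /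
A. I. Vinogradov 1965; Iwaniec–Kowalski Thm 17.1). [folklore] -/
theorem primesHaveLevel_half : PrimesHaveLevel (1 / 2) :=
  primesHaveLevel_of_forall_lt BombieriVinogradovStatement_holds

/-- **The level of distribution of the primes exists as a number.** There is `ϑ ∈ [1/2, 1]` such that
`PrimesHaveLevel θ ↔ θ ≤ ϑ` for every real `θ`: the set of admissible exponents is a nonempty
(`primesHaveLevel_half`) down-set (`PrimesHaveLevel.mono`), bounded above by `1`
(`PrimesHaveLevel.le_one`), and contains its supremum (`primesHaveLevel_of_forall_lt`). [folklore] -/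
theorem exists_levelOfDistribution :
    ∃ ϑ : ℝ, 1 / 2 ≤ ϑ ∧ ϑ ≤ 1 ∧ ∀ θ : ℝ, Literature.NumberTheory.Sieve.PrimesHaveLevel θ ↔ θ ≤ ϑ := by
  set S : Set ℝ := {θ | PrimesHaveLevel θ} with hS
  have hne : S.Nonempty := ⟨1 / 2, primesHaveLevel_half⟩
  have hbdd : BddAbove S := ⟨1, fun θ hθ => PrimesHaveLevel.le_one hθ⟩
  refine ⟨sSup S, le_csSup hbdd primesHaveLevel_half, csSup_le hne fun θ hθ => PrimesHaveLevel.le_one hθ,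
    fun θ => ⟨fun h => le_csSup hbdd h, fun hle => ?_⟩⟩
  refine primesHaveLevel_of_forall_lt fun θ' hθ' => ?_
  obtain ⟨θ'', hθ''S, hlt⟩ := exists_lt_of_lt_csSup hne (lt_of_lt_of_le hθ' hle)
  exact PrimesHaveLevel.mono hθ''S hlt.le

/-- **The crux says exactly `ϑ = 1`**: for the `ϑ` of `exists_levelOfDistribution` (indeed for any `ϑ`
with `PrimesHaveLevel θ ↔ θ ≤ ϑ` for all `θ`), `EH ↔ ϑ = 1`. [folklore] -/
theorem eh_iff_levelOfDistribution_eq_one {ϑ : ℝ} (hϑ : ∀ θ : ℝ, PrimesHaveLevel θ ↔ θ ≤ ϑ) :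
    EH ↔ ϑ = 1 := by
  have hϑ1 : ϑ ≤ 1 := PrimesHaveLevel.le_one ((hϑ ϑ).mpr le_rfl)
  constructor
  · intro h
    refine le_antisymm hϑ1 ?_
    have h1 : PrimesHaveLevel 1 := primesHaveLevel_of_forall_lt fun θ' hθ' => h θ' hθ'
    exact (hϑ 1).mp h1
  · intro h θ hθ
    exact (hϑ θ).mpr (by linarith)

/-- **`EH ↔ PrimesHaveLevel 1`** for this route's decl (the `θ < 1` family is the endpoint statement;
cf. the twin `…Theorems.ElliottHalberstam.Negative.elliottHalberstam_iff_primesHaveLevel_one` for the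
Literature constant, of which `EH` is the `Iff.rfl` spelling). [folklore] -/
theorem eh_iff_primesHaveLevel_one : EH ↔ PrimesHaveLevel 1 :=
  ⟨fun h => primesHaveLevel_of_forall_lt fun θ' hθ' => h θ' hθ', fun h _ hθ => h.mono hθ.le⟩

/-- **Only the open interval `(1/2, 1)` has content**: `EH ↔ ∀ θ, 1/2 < θ → θ < 1 → PrimesHaveLevel θ`
(the closed endpoint `θ = 1/2` is the theorem `primesHaveLevel_half`, everything below it follows by
monotonicity). [folklore] -/
theorem eh_iff_Ioo_half : EH ↔ ∀ θ : ℝ, 1 / 2 < θ → θ < 1 → PrimesHaveLevel θ := by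
  constructor
  · exact fun h θ _ hθ => h θ hθ
  · intro h θ hθ
    rcases le_or_gt θ (1 / 2) with hle | hgt
    · exact primesHaveLevel_half.mono hle
    · exact h θ hgt hθ

/-- **Where a counterexample must live**: `¬ EH ↔ ∃ θ, 1/2 < θ ∧ θ < 1 ∧ ¬ PrimesHaveLevel θ` — strictly
above the Bombieri–Vinogradov exponent (sharpening `[1/2, 1)` of the disprover's `not_eh_iff`), and
then failure propagates to every larger exponent (`PrimesHaveLevel.mono`). [folklore] -/
theorem not_eh_iff_Ioo_half :
    ¬ Summit.Parity.GeneralizedHardyLittlewood.Theses.LiouvilleShiftedTables.EH ↔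
      ∃ θ : ℝ, 1 / 2 < θ ∧ θ < 1 ∧ ¬ Literature.NumberTheory.Sieve.PrimesHaveLevel θ := by
  rw [eh_iff_Ioo_half]
  push Not
  rfl

/-- The failure set is open: if level `x^θ` fails then some strictly smaller exponent already fails
(contrapositive of `primesHaveLevel_of_forall_lt`) — there is no least failing exponent. [folklore] -/
theorem exists_lt_not_primesHaveLevel {θ : ℝ} (h : ¬ PrimesHaveLevel θ) :
    ∃ θ' : ℝ, θ' < θ ∧ ¬ PrimesHaveLevel θ' := by
  by_contra hall
  push Not at hall
  exact h (primesHaveLevel_of_forall_lt hall)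

end Summit.Parity.GeneralizedHardyLittlewood.Theorems.EH.LevelClosure
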